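import Summits.RiemannHypothesis.RiemannHypothesis.Theorems.WeilGroundStateGroundStatesConvergeToXiRenormBlowup
import HarnessLib

/-!
# `WeilGroundState.GroundStatesConvergeToXi` — LINE-ONLY form of the renormalisation blow-up
theorem (crux item stmt-RiemannHypothesis-1527, route route-RiemannHypothesis-WeilGroundState;
`--supports`; handoff track ROUTE 1′, task P1 of idea-3 gen23, HOME/handoff/IDEAS-finite-rank.md
v3.4 §G23-1 (E3) / §G23-5; prove-2 gen9 ATTEMPT-17)

RH-free.  The tree's `riemannHypothesis_of_cruxWitness_norm_le` (`…RenormBlowup.lean`) assumes the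
crux's clause `c_k · weilMellin u_k → ξ` LOCALLY UNIFORMLY ON THE OPEN STRIP `{0 < Re s < 1}`, but
its proof consumes that clause once, through `eventually_norm_fourier_sub_riemannXi_lt`
(`…RenormBlowupPrelim.lean`): uniform convergence of `c_k 𝓕u_k` to `ξ(1/2 + 2πi·)` on compact
FREQUENCY WINDOWS `[-R, R]` — a statement on the critical line alone.  This file records the
theorems with that weaker hypothesis:
* `exists_eventually_norm_overlap_ge_of_line` — core estimate (proof = the tree's, verbatim, with
  the one strip line replaced): line convergence ⟹ for every `M > 0` some `L > 0` with
  `‖⟨u_k, φ_{a_k}⟩‖ ≥ L` for all large `k` such that `‖c_k‖ ≤ M`;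
* `riemannHypothesis_of_lineWitness_norm_le` — **line convergence + `‖c_k‖ ≤ M` frequently ⟹ RH**
  (`lineWitness_of_strip`: the tree's strip theorem is the special case); `lineWitness_of_criticalLine` / `riemannHypothesis_of_criticalLineWitness_norm_le`
  — the hypothesis phrased with `weilMellin` on `1/2 + iy`, `|y| ≤ Y`;
* real normalisers `c_k = e^{-α_k}`, `α_k` bounded BELOW frequently:
  `riemannHypothesis_of_expNormaliser_bddBelow`; real-indexed families:
  `riemannHypothesis_of_lineFamily_bddBelow` (ground states `u_t` at windows `a(t) → ∞`,
  `e^{-α_t} û_t → Ξ` uniformly on every real segment `[-T, T]`, `α_t ≥ m` frequently ⟹ RH) and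
  `riemannHypothesis_of_thinFamily_bddBelow` (the hypothesis in the THIN-RECTANGLE shape of idea-3's
  SC-3 / prove-1's `CountThin`: even transforms, `[0, T] × [-δ, δ]`).
Reading (idea-3 §G23-1 (E3)): for the Weil ground-state family, THIN (indeed LINE) convergence with
a normaliser bounded below is RH-strong by the tree's overlap mechanism — no count law, no parity /
simplicity, no Hurwitz; the data side (§G23-3) has `α_t → -log ‖Φ‖₂ = 0.5701`.  Nothing here is,
or suggests, a proof of RH: every statement is an implication from an open hypothesis about the
Weil ground states.  No new definitions.
-/

noncomputable section

set_option linter.dupNamespace false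

open scoped Topology Real ComplexConjugate FourierTransform
open Filter Set MeasureTheory Complex

namespace Summit.RiemannHypothesis.RiemannHypothesis.Theorems.GroundStatesConvergeToXi

open Literature.NumberTheory.LFunctions

/-! ## The core estimate with the line-only hypothesis -/

set_option maxHeartbeats 400000 in
/-- **Core estimate, line-only hypothesis (RH-free).**  Ground states `u_k` at windows `a_k → ∞`,
scalars `c_k` with `sup_{|ξ| ≤ R} ‖c_k 𝓕u_k(ξ) − ξ(1/2 + 2πiξ)‖ → 0` for every `R` (compact pieces of
the critical line only): for every `M > 0` there is `L > 0` with `‖⟨u_k, φ_{a_k}⟩‖ ≥ L` for all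
large `k` such that `‖c_k‖ ≤ M`.  Proof = that of `exists_eventually_norm_overlap_ge` verbatim
(Parseval splitting, window-uniform tail bound from Plancherel, bulk bound on `[-R, R]` — the only
place the convergence enters). -/
theorem exists_eventually_norm_overlap_ge_of_line {a : ℕ → ℝ} {u : ℕ → ℝ → ℂ} {c : ℕ → ℂ}
    (ha : Tendsto a atTop atTop) (hu : ∀ k, IsWeilGroundState (a k) (u k))
    (hline : ∀ R : ℝ, ∀ ε : ℝ, 0 < ε → ∀ᶠ k in atTop, ∀ ξ ∈ Icc (-R) R,
      ‖c k * 𝓕 (u k) ξ - riemannXi (1 / 2 + ((2 * π * ξ : ℝ) : ℂ) * I)‖ < ε)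
    {M : ℝ} (hM : 0 < M) :
    ∃ L : ℝ, 0 < L ∧ ∀ᶠ k in atTop, ‖c k‖ ≤ M →
      L ≤ ‖∫ t, u k t * conj ((2 : ℂ) * LagariasMontague.Psic (2 * t) *
        ((Literature.Analysis.Calculus.cutoff (a k) t : ℝ) : ℂ))‖ := by
  -- notation and constants
  set φ : ℝ → ℝ → ℂ := fun A t => (2 : ℂ) * LagariasMontague.Psic (2 * t) *
    ((Literature.Analysis.Calculus.cutoff A t : ℝ) : ℂ) with hφdef
  set g : ℝ → ℝ := fun ξ => ‖riemannXi (1 / 2 + ((2 * π * ξ : ℝ) : ℂ) * I)‖ ^ 2 with hgdef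
  set η : ℝ → ℝ := fun A => Real.exp (-(π / 4 * Real.exp (2 * (A - 1)))) with hηdef
  set B₁ : ℝ := LagariasMontague.fourierDecayConst + 1 with hB₁def
  have hB₁ : 0 < B₁ := by
    have := fourierDecayConst_nonneg; rw [hB₁def]; linarith
  obtain ⟨hgi, -, hJpos⟩ := integral_norm_sq_riemannXi_eq_and_pos
  set J : ℝ := ∫ ξ, g ξ with hJdef
  obtain ⟨D, hD0, hD⟩ := exists_norm_tail_fourier_overlap_le
  obtain ⟨E, hE0, hE⟩ := exists_norm_bulk_fourier_overlap_sub_le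
  have hη0 : ∀ A, 0 < η A := fun A => Real.exp_pos _
  have hη1 : ∀ A, η A ≤ 1 := fun A => by
    rw [hηdef]
    exact Real.exp_le_one_iff.2 (by
      have := Real.exp_pos (2 * (A - 1)); nlinarith [Real.pi_gt_three])
  set θ : ℝ := J / (8 * M) with hθdef
  have hθ0 : 0 < θ := by positivity
  set δ₁ : ℝ := min (J ^ 2 / (128 * M ^ 2)) (J / 4) with hδ₁def
  have hδ₁0 : 0 < δ₁ := by positivity
  -- tails of `g`: pick `R ≥ 1` with `∫_{[-R,R]ᶜ} g ≤ δ₁`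
  have hcompl : ∀ n : ℕ, ∫ ξ in (Icc (-(n : ℝ)) n)ᶜ, g ξ = J - ∫ ξ in Icc (-(n : ℝ)) n, g ξ := by
    intro n
    have := integral_add_compl (measurableSet_Icc (a := -(n : ℝ)) (b := n)) hgi
    rw [hJdef]; linarith
  have htail : Tendsto (fun n : ℕ => ∫ ξ in (Icc (-(n : ℝ)) n)ᶜ, g ξ) atTop (𝓝 0) := by
    have hmono : Monotone fun n : ℕ => Icc (-(n : ℝ)) n := by
      intro m n hmn
      have h : (m : ℝ) ≤ n := by exact_mod_cast hmn
      exact Icc_subset_Icc (by linarith) h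
    have hU : (⋃ n : ℕ, Icc (-(n : ℝ)) n) = univ := by
      refine eq_univ_of_forall fun x => ?_
      obtain ⟨n, hn⟩ := exists_nat_ge |x|
      exact mem_iUnion.2 ⟨n, abs_le.1 hn⟩
    have h1 := tendsto_setIntegral_of_monotone (μ := volume) (f := g)
      (fun n : ℕ => (measurableSet_Icc : MeasurableSet (Icc (-(n : ℝ)) n))) hmono
      (by rw [hU]; exact hgi.integrableOn)
    rw [hU, setIntegral_univ] at h1
    have h2 := (tendsto_const_nhds (x := J)).sub h1
    rw [← hJdef, sub_self] at h2
    refine h2.congr fun n => ?_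
    rw [hcompl n]
  obtain ⟨R, hRtail, hR1⟩ := ((htail.eventually (ge_mem_nhds hδ₁0)).and
    (eventually_ge_atTop 1)).exists
  have hR0 : (0 : ℝ) ≤ R := by positivity
  set S : Set ℝ := Icc (-(R : ℝ)) R with hSdef
  have hS : MeasurableSet S := measurableSet_Icc
  -- the small parameters in `k`
  set ε₁ : ℝ := J / (64 * R * B₁ * (E + 1)) with hε₁def
  have hε₁0 : 0 < ε₁ := by positivity
  set ε₂ : ℝ := min ε₁ (J ^ 2 / (128 * M ^ 2 * (π * D ^ 2 + 1))) with hε₂def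
  have hε₂0 : 0 < ε₂ := by positivity
  have hηa : Tendsto (fun k => η (a k)) atTop (𝓝 0) := tendsto_superexp_zero.comp ha
  refine ⟨J / (2 * M), by positivity, ?_⟩
  filter_upwards [ha.eventually (eventually_ge_atTop (1 : ℝ)), hline R ε₁ hε₁0,
    hηa.eventually (ge_mem_nhds hε₂0)] with k hak hbulk hηk hcM
  have hηk0 := hη0 (a k)
  have hηk1 := hη1 (a k)
  -- splitting, tail, bulk at step `k`
  obtain ⟨-, hP⟩ := overlap_eq_bulk_add_tail (hu k) hS
  have hT := hD (a k) hak (u k) (hu k) S hS θ hθ0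
  have hBu := hE (a k) hak (u k) (hu k) (c k) R hR0 ε₁ hε₁0.le (fun ξ hξ => (hbulk ξ hξ).le)
  set bulk : ℂ := ∫ ξ in S, 𝓕 (u k) ξ * 𝓕⁻ (φ (a k)) ξ with hbulkdef
  set tail : ℂ := ∫ ξ in Sᶜ, 𝓕 (u k) ξ * 𝓕⁻ (φ (a k)) ξ with htaildef
  have hP' : (∫ t, u k t * conj (φ (a k) t)) = bulk + tail := hP
  have hT' : ‖tail‖ ≤ θ / 2 + 1 / (2 * θ) * (2 * (∫ ξ in Sᶜ, g ξ) + 2 * π * (D * η (a k)) ^ 2) := hT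
  have hBu' : ‖c k * bulk - ((∫ ξ in S, g ξ : ℝ) : ℂ)‖ ≤ 2 * R * (B₁ * (ε₁ + η (a k))) * (E + 1) := hBu
  -- (1) the tail is small: `M ‖tail‖ ≤ 3J/16`
  have htail_le : M * ‖tail‖ ≤ 3 * J / 16 := by
    have h3 : (D * η (a k)) ^ 2 ≤ D ^ 2 * η (a k) := by
      rw [mul_pow]
      refine mul_le_mul_of_nonneg_left ?_ (by positivity)
      nlinarith
    have hRt : ∫ ξ in Sᶜ, g ξ ≤ δ₁ := hRtail
    have h4 : ‖tail‖ ≤ θ / 2 + δ₁ / θ + π * D ^ 2 * η (a k) / θ := by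
      refine hT'.trans ?_
      have hθ' : 0 ≤ 1 / (2 * θ) := by positivity
      have h5 : 2 * (∫ ξ in Sᶜ, g ξ) + 2 * π * (D * η (a k)) ^ 2 ≤
          2 * δ₁ + 2 * π * (D ^ 2 * η (a k)) := by nlinarith [Real.pi_pos]
      have h6 := mul_le_mul_of_nonneg_left h5 hθ'
      have e : 1 / (2 * θ) * (2 * δ₁ + 2 * π * (D ^ 2 * η (a k))) =
          δ₁ / θ + π * D ^ 2 * η (a k) / θ := by
        field_simp
      linarith
    have hm1 : M * (θ / 2) = J / 16 := by
      rw [hθdef]; field_simp; ring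
    have hm2 : M * (δ₁ / θ) ≤ J / 16 := by
      have hδ : δ₁ ≤ J ^ 2 / (128 * M ^ 2) := min_le_left _ _
      rw [le_div_iff₀ (by positivity)] at hδ
      have e : M * (δ₁ / θ) = 8 * M ^ 2 * δ₁ / J := by
        rw [hθdef]; field_simp
      rw [e, div_le_div_iff₀ hJpos (by norm_num : (0 : ℝ) < 16)]
      linarith [hδ]
    have hm3 : M * (π * D ^ 2 * η (a k) / θ) ≤ J / 16 := by
      have hη2 : η (a k) ≤ J ^ 2 / (128 * M ^ 2 * (π * D ^ 2 + 1)) :=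
        hηk.trans (min_le_right _ _)
      rw [le_div_iff₀ (by positivity)] at hη2
      have e : M * (π * D ^ 2 * η (a k) / θ) = 8 * M ^ 2 * π * D ^ 2 * η (a k) / J := by
        rw [hθdef]; field_simp
      rw [e, div_le_div_iff₀ hJpos (by norm_num : (0 : ℝ) < 16)]
      have h4 : 0 ≤ M ^ 2 * η (a k) := by positivity
      linarith [hη2, h4]
    have h7 := mul_le_mul_of_nonneg_left h4 hM.le
    rw [mul_add, mul_add, hm1] at h7
    linarith
  -- (2) the bulk is large: `‖c_k bulk‖ ≥ 11J/16`
  have hbulk_ge : 11 * J / 16 ≤ ‖c k * bulk‖ := by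
    have hgS : 3 * J / 4 ≤ ∫ ξ in S, g ξ := by
      have h1 := hcompl R
      have h2 : δ₁ ≤ J / 4 := min_le_right _ _
      have h3 : ∫ ξ in Sᶜ, g ξ ≤ δ₁ := hRtail
      rw [hSdef]
      linarith
    have hsmall : 2 * R * (B₁ * (ε₁ + η (a k))) * (E + 1) ≤ J / 16 := by
      have hη2 : η (a k) ≤ ε₁ := hηk.trans (min_le_left _ _)
      have h1 : 2 * R * (B₁ * (ε₁ + η (a k))) * (E + 1) ≤ 2 * R * (B₁ * (ε₁ + ε₁)) * (E + 1) := by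
        gcongr
      have e : 2 * R * (B₁ * (ε₁ + ε₁)) * (E + 1) = J / 16 := by
        rw [hε₁def]; field_simp; ring
      linarith
    have h1 : ‖((∫ ξ in S, g ξ : ℝ) : ℂ)‖ = ∫ ξ in S, g ξ := by
      rw [Complex.norm_real, Real.norm_eq_abs,
        abs_of_nonneg (setIntegral_nonneg hS fun _ _ => by positivity)]
    have h2 := norm_sub_norm_le (((∫ ξ in S, g ξ : ℝ) : ℂ)) (c k * bulk)
    rw [norm_sub_rev] at hBu'
    linarith
  -- (3) combine
  have hkey : J / 2 ≤ ‖c k‖ * ‖∫ t, u k t * conj (φ (a k) t)‖ := by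
    rw [← norm_mul, hP', mul_add]
    have h1 : ‖c k * bulk‖ ≤ ‖c k * bulk + c k * tail‖ + ‖c k * tail‖ := by
      have := norm_add_le (c k * bulk + c k * tail) (-(c k * tail))
      rwa [add_neg_cancel_right, norm_neg] at this
    have h2 : ‖c k * tail‖ ≤ M * ‖tail‖ := by
      rw [norm_mul]
      exact mul_le_mul_of_nonneg_right hcM (norm_nonneg _)
    linarith
  have hfin : J / 2 ≤ M * ‖∫ t, u k t * conj (φ (a k) t)‖ :=
    hkey.trans (mul_le_mul_of_nonneg_right hcM (norm_nonneg _))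
  rw [div_le_iff₀ (by positivity)]
  nlinarith [hfin]

/-! ## Line convergence with bounded renormalisation constants forces RH -/

/-- **A LINE witness whose renormalisation constants are bounded along a subsequence proves RH
(RH-free mechanism).**  `a_k → ∞`, `u_k` ground states at `a_k`, `c_k 𝓕u_k → ξ(1/2 + 2πi·)`
uniformly on every compact frequency window `[-R, R]` (equivalently `c_k û_k → ξ` uniformly on
compact pieces of the critical line), `‖c_k‖ ≤ M` frequently ⟹ RH.  Endgame as in
`riemannHypothesis_of_cruxWitness_norm_le`: overlaps `≥ L` along the bounded subsequence,
`|ε(a_k)|·‖⟨u_k, φ_{a_k}⟩‖ ≤ K e^{−(π/4)e^{2(a_k−1)}} e^{3a_k/2} → 0`, so `ε(a_k) ≥ −1` frequently,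
`ε` antitone ⇒ bounded below ⇒ RH.  The open STRIP never enters. -/
theorem riemannHypothesis_of_lineWitness_norm_le {a : ℕ → ℝ} {u : ℕ → ℝ → ℂ} {c : ℕ → ℂ}
    (ha : Tendsto a atTop atTop) (hu : ∀ k, IsWeilGroundState (a k) (u k))
    (hline : ∀ R : ℝ, ∀ ε : ℝ, 0 < ε → ∀ᶠ k in atTop, ∀ ξ ∈ Icc (-R) R,
      ‖c k * 𝓕 (u k) ξ - riemannXi (1 / 2 + ((2 * π * ξ : ℝ) : ℂ) * I)‖ < ε)
    (hM : ∃ M : ℝ, ∃ᶠ k in atTop, ‖c k‖ ≤ M) : RiemannHypothesis := by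
  obtain ⟨M, hMf⟩ := hM
  set M' : ℝ := max M 1 with hM'def
  have hM' : 0 < M' := lt_of_lt_of_le one_pos (le_max_right _ _)
  have hMf' : ∃ᶠ k in atTop, ‖c k‖ ≤ M' := hMf.mono fun k hk => hk.trans (le_max_left _ _)
  obtain ⟨L, hL0, hL⟩ := exists_eventually_norm_overlap_ge_of_line ha hu hline hM'
  obtain ⟨K, hK0, hK⟩ := exists_abs_weilGroundEnergy_mul_norm_overlap_le_exp
  have hzero : Tendsto (fun k => K / L * (Real.exp (-(π / 4 * Real.exp (2 * (a k - 1)))) *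
      Real.exp (3 / 2 * a k))) atTop (𝓝 0) := by
    simpa using (tendsto_superexp_mul_exp_threeHalves_zero.comp ha).const_mul (K / L)
  have hev : ∀ᶠ k in atTop, ‖c k‖ ≤ M' → -1 ≤ weilGroundEnergy (a k) := by
    filter_upwards [hL, ha.eventually (eventually_ge_atTop (1 : ℝ)),
      hzero.eventually (ge_mem_nhds one_pos)] with k hk hak hsmall hcM
    have h1 := hK (a k) hak (u k) (hu k)
    have h2 := hk hcM
    have h3 : |weilGroundEnergy (a k)| * L ≤ K * (Real.exp (-(π / 4 * Real.exp (2 * (a k - 1)))) *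
        Real.exp (3 / 2 * a k)) :=
      (mul_le_mul_of_nonneg_left h2 (abs_nonneg _)).trans h1
    have h4 : |weilGroundEnergy (a k)| ≤ K / L * (Real.exp (-(π / 4 * Real.exp (2 * (a k - 1)))) *
        Real.exp (3 / 2 * a k)) := by
      rw [div_mul_eq_mul_div, le_div_iff₀ hL0]
      exact h3
    have h5 := (abs_le.1 (h4.trans hsmall)).1
    linarith
  have hfreq : ∃ᶠ k in atTop, -1 ≤ weilGroundEnergy (a k) :=
    (hMf'.and_eventually hev).mono fun k hk => hk.2 hk.1
  refine riemannHypothesis_of_weilGroundEnergy_bddBelow ⟨-1, fun b hb => ?_⟩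
  obtain ⟨k, hk1, hk2⟩ := (hfreq.and_eventually (ha.eventually (eventually_ge_atTop b))).exists
  exact hk1.trans
    (Summit.RiemannHypothesis.Cruxes.GronwallLeakage.Negative.weilGroundEnergy_antitone_of_pos hb hk2)

/-! ## The strip clause and the critical-line clause both give the line hypothesis -/

/-- The crux's STRIP clause (`c_k · weilMellin u_k → ξ` locally uniformly on `{0 < Re s < 1}`)
implies the LINE hypothesis of this file (by `eventually_norm_fourier_sub_riemannXi_lt`); hence the
tree's `riemannHypothesis_of_cruxWitness_norm_le` is literally
`riemannHypothesis_of_lineWitness_norm_le ha hu (lineWitness_of_strip hlim) hM`. [folklore] -/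
theorem lineWitness_of_strip {u : ℕ → ℝ → ℂ} {c : ℕ → ℂ}
    (hlim : TendstoLocallyUniformlyOn (fun k s => c k * weilMellin (u k) s) riemannXi atTop
      {s : ℂ | 0 < s.re ∧ s.re < 1}) :
    ∀ R : ℝ, ∀ ε : ℝ, 0 < ε → ∀ᶠ k in atTop, ∀ ξ ∈ Icc (-R) R,
      ‖c k * 𝓕 (u k) ξ - riemannXi (1 / 2 + ((2 * π * ξ : ℝ) : ℂ) * I)‖ < ε :=
  fun R _ hε => eventually_norm_fourier_sub_riemannXi_lt hlim R hε

/-- The line hypothesis in the `weilMellin` phrasing: if `c_k û_k(1/2 + iy) → ξ(1/2 + iy)` uniformly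
on `|y| ≤ Y` for every `Y`, then `c_k 𝓕u_k → ξ(1/2 + 2πi·)` uniformly on every `[-R, R]`
(`𝓕u(ξ) = û(1/2 − 2πiξ)` and `ξ` is even on the line). [folklore] -/
theorem lineWitness_of_criticalLine {u : ℕ → ℝ → ℂ} {c : ℕ → ℂ}
    (hcrit : ∀ Y : ℝ, TendstoUniformlyOn
      (fun k (y : ℝ) => c k * weilMellin (u k) (1 / 2 + (y : ℂ) * I))
      (fun y : ℝ => riemannXi (1 / 2 + (y : ℂ) * I)) atTop (Icc (-Y) Y)) :
    ∀ R : ℝ, ∀ ε : ℝ, 0 < ε → ∀ᶠ k in atTop, ∀ ξ ∈ Icc (-R) R,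
      ‖c k * 𝓕 (u k) ξ - riemannXi (1 / 2 + ((2 * π * ξ : ℝ) : ℂ) * I)‖ < ε := by
  intro R ε hε
  have h := Metric.tendstoUniformlyOn_iff.1 (hcrit (2 * π * R)) ε hε
  filter_upwards [h] with k hk ξ hξ
  have hy : (-2 * π * ξ : ℝ) ∈ Icc (-(2 * π * R)) (2 * π * R) := by
    constructor <;> nlinarith [hξ.1, hξ.2, Real.pi_pos]
  have h1 := hk (-2 * π * ξ) hy
  rw [dist_eq_norm, norm_sub_rev] at h1
  rw [Negative.fourier_eq_weilMellin, show (2 * π * ξ : ℝ) = -(-2 * π * ξ) by ring,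
    LagariasMontague.riemannXi_criticalLine_neg]
  exact h1

/-- **Critical-line witness with `‖c_k‖ ≤ M` frequently ⟹ RH**: ground states `u_k` at windows
`a_k → ∞`, scalars `c_k` with `c_k û_k → ξ` uniformly on every compact piece `{1/2 + iy : |y| ≤ Y}`
of the critical line and `‖c_k‖ ≤ M` along a subsequence prove RH. [folklore] -/
theorem riemannHypothesis_of_criticalLineWitness_norm_le {a : ℕ → ℝ} {u : ℕ → ℝ → ℂ} {c : ℕ → ℂ}
    (ha : Tendsto a atTop atTop) (hu : ∀ k, IsWeilGroundState (a k) (u k))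
    (hcrit : ∀ Y : ℝ, TendstoUniformlyOn
      (fun k (y : ℝ) => c k * weilMellin (u k) (1 / 2 + (y : ℂ) * I))
      (fun y : ℝ => riemannXi (1 / 2 + (y : ℂ) * I)) atTop (Icc (-Y) Y))
    (hM : ∃ M : ℝ, ∃ᶠ k in atTop, ‖c k‖ ≤ M) : RiemannHypothesis :=
  riemannHypothesis_of_lineWitness_norm_le ha hu (lineWitness_of_criticalLine hcrit) hM

/-! ## Real normalisers: `c_k = e^{-α_k}` with `α_k` bounded below -/

/-- **Real exponential normaliser bounded below ⟹ RH.**  Ground states `u_k` at windows `a_k → ∞`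
with `e^{-α_k} û_k(1/2 + iy) → ξ(1/2 + iy)` uniformly on every `|y| ≤ Y` and `α_k ≥ m` frequently
(so `‖c_k‖ = e^{-α_k} ≤ e^{-m}`) prove RH. [folklore] -/
theorem riemannHypothesis_of_expNormaliser_bddBelow {a : ℕ → ℝ} {u : ℕ → ℝ → ℂ} {α : ℕ → ℝ}
    (ha : Tendsto a atTop atTop) (hu : ∀ k, IsWeilGroundState (a k) (u k))
    (hcrit : ∀ Y : ℝ, TendstoUniformlyOn
      (fun k (y : ℝ) => ((Real.exp (-α k) : ℝ) : ℂ) * weilMellin (u k) (1 / 2 + (y : ℂ) * I))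
      (fun y : ℝ => riemannXi (1 / 2 + (y : ℂ) * I)) atTop (Icc (-Y) Y))
    (hα : ∃ m : ℝ, ∃ᶠ k in atTop, m ≤ α k) : RiemannHypothesis := by
  obtain ⟨m, hm⟩ := hα
  refine riemannHypothesis_of_criticalLineWitness_norm_le (c := fun k => ((Real.exp (-α k) : ℝ) : ℂ))
    ha hu hcrit ⟨Real.exp (-m), hm.mono fun k hk => ?_⟩
  rw [Complex.norm_real, Real.norm_eq_abs, abs_of_pos (Real.exp_pos _)]
  exact Real.exp_le_exp.2 (by linarith)

/-! ## Real-indexed families (the shape of idea-3's SC-3 / prove-1's `CountThin`) -/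

/-- From `∃ᶠ t in atTop, P t` on `ℝ` extract a sequence `t_k → ∞` with `P (t_k)` for all `k`.
[folklore] -/
theorem exists_seq_tendsto_of_frequently {P : ℝ → Prop} (h : ∃ᶠ t in atTop, P t) :
    ∃ t : ℕ → ℝ, Tendsto t atTop atTop ∧ ∀ k, P (t k) := by
  have h' : ∀ k : ℕ, ∃ s : ℝ, (k : ℝ) ≤ s ∧ P s := fun k =>
    let ⟨s, hs, hP⟩ := (Filter.frequently_atTop.1 h) k
    ⟨s, hs, hP⟩
  choose t ht hP using h'
  exact ⟨t, tendsto_atTop_mono ht tendsto_natCast_atTop_atTop, hP⟩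

/-- **Real-indexed LINE family ⟹ RH.**  Let `u_t` be ground states at windows `a(t) → ∞`
(eventually in `t`), `α : ℝ → ℝ` a real normaliser with
`e^{-α_t} û_t(1/2 + iy) → Ξ(y) = ξ(1/2 + iy)` uniformly on every real segment `[-T, T]` as
`t → ∞`, and `α_t ≥ m` frequently (the normaliser does not run off to `-∞` along some sequence).
Then RH.  (`û_t(1/2 + iy) = weilMellin u_t (1/2 + iy)`; `Ξ = riemannXiUpper`.)  No count law,
no parity, no simplicity: idea-3 §G23-1 (E3). [folklore] -/
theorem riemannHypothesis_of_lineFamily_bddBelow {a : ℝ → ℝ} {u : ℝ → ℝ → ℂ} {α : ℝ → ℝ}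
    (ha : Tendsto a atTop atTop) (hu : ∀ᶠ t in atTop, IsWeilGroundState (a t) (u t))
    (hconv : ∀ T : ℝ, TendstoUniformlyOn
      (fun t (y : ℝ) => ((Real.exp (-α t) : ℝ) : ℂ) * weilMellin (u t) (1 / 2 + I * (y : ℂ)))
      (fun y : ℝ => riemannXiUpper y) atTop (Icc (-T) T))
    (hα : ∃ m : ℝ, ∃ᶠ t in atTop, m ≤ α t) : RiemannHypothesis := by
  obtain ⟨m, hm⟩ := hα
  obtain ⟨t, ht, hPt⟩ := exists_seq_tendsto_of_frequently (hm.and_eventually hu)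
  refine riemannHypothesis_of_expNormaliser_bddBelow (a := fun k => a (t k)) (u := fun k => u (t k))
    (α := fun k => α (t k)) (ha.comp ht) (fun k => (hPt k).2) (fun Y => ?_)
    ⟨m, Frequently.of_forall fun k => (hPt k).1⟩
  have h := Metric.tendstoUniformlyOn_iff.1 (hconv Y)
  refine Metric.tendstoUniformlyOn_iff.2 fun ε hε => ?_
  filter_upwards [ht.eventually (h ε hε)] with k hk y hy
  have h1 := hk y hy
  simp only [riemannXiUpper] at h1
  rw [mul_comm I (y : ℂ)] at h1
  exact h1

/-- **THIN-RECTANGLE family (SC-3 shape) with normaliser bounded below ⟹ RH.**  Ground states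
`u_t` at windows `a(t) → ∞` (eventually) with EVEN transforms `û_t(z) := weilMellin u_t (1/2 + iz)`
(e.g. `u_t` even), `δ ≥ 0` (only the real segment is used), a real normaliser `α` with
`e^{-α_t} û_t → Ξ` uniformly on every thin rectangle `[0, T] × [-δ, δ]` (`T > 0`) and `α_t ≥ m`
frequently ⟹ RH.  This is prove-1's `CountThin.riemannHypothesis_of_count_of_thin` for the
ground-state family with the COUNT LAW REMOVED and the normaliser clause added (idea-3 §G23-5 P1:
«ThinConvergence (ground-state family, α bounded below) ⟹ RH, CountLaw idle»). [folklore] -/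
theorem riemannHypothesis_of_thinFamily_bddBelow {a : ℝ → ℝ} {u : ℝ → ℝ → ℂ} {α : ℝ → ℝ} {δ : ℝ}
    (ha : Tendsto a atTop atTop) (hu : ∀ᶠ t in atTop, IsWeilGroundState (a t) (u t))
    (heven : ∀ᶠ t in atTop, ∀ z : ℂ,
      weilMellin (u t) (1 / 2 + I * -z) = weilMellin (u t) (1 / 2 + I * z))
    (hδ : 0 ≤ δ)
    (hthin : ∀ T : ℝ, 0 < T → TendstoUniformlyOn
      (fun t (z : ℂ) => ((Real.exp (-α t) : ℝ) : ℂ) * weilMellin (u t) (1 / 2 + I * z))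
      riemannXiUpper atTop (Icc 0 T ×ℂ Icc (-δ) δ))
    (hα : ∃ m : ℝ, ∃ᶠ t in atTop, m ≤ α t) : RiemannHypothesis := by
  refine riemannHypothesis_of_lineFamily_bddBelow ha hu (fun T => ?_) hα
  refine Metric.tendstoUniformlyOn_iff.2 fun ε hε => ?_
  have hT1 : 0 < |T| + 1 := by positivity
  have h := Metric.tendstoUniformlyOn_iff.1 (hthin (|T| + 1) hT1) ε hε
  filter_upwards [h, heven] with t ht hev y hy
  have hyT : |y| ≤ |T| + 1 := by
    have : |y| ≤ |T| :=
      abs_le.2 ⟨by linarith [hy.1, hy.2, neg_abs_le T, le_abs_self T], hy.2.trans (le_abs_self T)⟩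
    linarith
  by_cases hy0 : 0 ≤ y
  · have hmem : ((y : ℝ) : ℂ) ∈ Icc (0 : ℝ) (|T| + 1) ×ℂ Icc (-δ) δ := by
      refine ⟨⟨?_, ?_⟩, ⟨?_, ?_⟩⟩ <;> simp [Complex.ofReal_re, Complex.ofReal_im]
      · exact hy0
      · rw [abs_of_nonneg hy0] at hyT; exact hyT
      · exact hδ
      · exact hδ
    exact ht (y : ℂ) hmem
  · have hmem : (((-y : ℝ) : ℝ) : ℂ) ∈ Icc (0 : ℝ) (|T| + 1) ×ℂ Icc (-δ) δ := by
      refine ⟨⟨?_, ?_⟩, ⟨?_, ?_⟩⟩ <;> simp [Complex.ofReal_re, Complex.ofReal_im]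
      · linarith
      · rw [abs_of_neg (lt_of_not_ge hy0)] at hyT; exact hyT
      · exact hδ
      · exact hδ
    have h1 := ht ((-y : ℝ) : ℂ) hmem
    have hneg : (((-y : ℝ)) : ℂ) = -(y : ℂ) := by push_cast; ring
    have e2 := riemannXiUpper_neg (y : ℂ)
    simp only [riemannXiUpper] at e2 h1 ⊢
    rw [hneg, hev (y : ℂ), e2] at h1
    exact h1

end Summit.RiemannHypothesis.RiemannHypothesis.Theorems.GroundStatesConvergeToXi

end
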